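import Mathlib
import Summits.NavierStokesRegularity.NavierStokesRegularity.Theorems.TaoLadderRungTwoBreakOneShiftSparseClosedForm
import Summits.NavierStokesRegularity.NavierStokesRegularity.Theorems.TaoLadderRungTwoBreakOneShiftT4W76RSized
import HarnessLib

/-!
# The one-shift instance T4 @ ε₀ = 1/10, W = 76, REPLAY-SIZED VARIANT (R): every frame / scalar / row hypothesis of
# `exists_surviving_dssWave_of_windowCert_v7s` DISCHARGED IN THE KERNEL (exact rational arithmetic) for the variant frame
# of `…T4W76RDefs` and GENEROUS certificate-side constants; what remains is the certificate side only
# (cell harvest/h2-tao-ladder, seat p2; rung1/RUNG1-P2G16-REPORT.md §79; support for K1(1) = `NoSurvivingDSSOne`,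
# stmt-NavierStokesRegularity-20205 — a counter-instance SHAPE at one (ε₀, α), it does not touch the item's quantifier
# `∃ ε_s ∀ ε₀ ≤ ε_s`)

MODEL lattice only (Tao-type averaged cascade with the comparable circuit table T4, scale ratio `11/10`);
nothing here is a statement about the Navier–Stokes equations; no item is closed; CONDITIONAL theorem.

`exists_surviving_dssWave_of_cert`: as `T4W76.exists_surviving_dssWave_of_cert` (module `…OneShiftT4W76`), for the
variant frame `T4W76R.frame bd` (wide hull `[gLo, gHi] = [1.03393, 1.03395]`, `r₀ = 8.16·10⁻⁵`, top ratio `1/16`; the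
SAME box data, tube centres, `κ`, `c_max`, `Q`, `S`, `ε`, `ε′`, `τ̂ ± r_τ`, table; top anchor `ā_t = 3·10⁻²⁴` of `…T4W76RSized`), with the eight certificate
clauses carrying generous constants — Krawczyk inclusion `hwinIn`, window block `Z = 1/50, S_b = 1/20, S_e = 10²⁸`,
`g ∈ [gLo, gHi]`, `γ = (10⁻⁶, 10⁻⁶, 10²²)`, bottom-shell `(10⁻³, 10⁻³, 10²⁰)`, per-shell `vmaxT4₂ / χbT4₂ / χeT4` of the
variant, amplitude hulls `AT4₂` (top anchor re-sized, `…T4W76RSized`), wake entry `A₁ = 10⁻⁵` — chosen so that a KERNEL replay (whose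
enclosures are wider than the interval engine's printed numbers, rung1/RUNG1-P2G15-REPORT.md §75) can serve them, while
the rows of `…_v7s` still close (`q = 13/25`; python exact-rational twin rung1/num4c/inst_T4W76R_exact.py, 76 checks).
The certificate side is NOT a kernel object here: this theorem is exactly as conditional as those eight clauses.
-/

noncomputable section

-- the sub-problem namespace repeats the summit name by design (D-0017)
set_option linter.dupNamespace false

namespace Summit.NavierStokesRegularity.NavierStokesRegularity.Theorems

namespace DSSOneShift

open Set Literature.Analysis.FluidPDE Literature.Analysis.FluidPDE.TaoCascade CertificateGlueOn

namespace T4W76R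

open T4W76 (ghat κw cmax Q S εR ωt τc rτ αT4 BoxData tubeCT4 bigLam_tenth_bounds abs_αT4_le_one
  tableAbsSum_αT4_le tubeCT4_wake tubeCT4_top)

variable (bd : BoxData)

/-! ### The instance theorem of the variant -/

/-- **T4 @ ε₀ = 1/10, W = 76 (replay-sized variant): a surviving admissible DSS blow-up wave of the bi-infinite T4
lattice, CONDITIONAL ON THE WINDOW CERTIFICATE ONLY.**  Every frame / scalar / row hypothesis of
`exists_surviving_dssWave_of_windowCert_v7s` is discharged by exact rational arithmetic in the kernel for the variant
frame `frame bd`; the hypotheses that remain are the certificate side with GENEROUS constants: the window certificate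
`cert`, the window amplitude hulls `hAwin` (`AT4₂`: `Q` on shell 0, `1` inside, `ā_t = 3·10⁻²⁴` on shell 75), the hull
`g ∈ [1.03393, 1.03395]` (`hgl`), the window-block Lipschitz numbers (`hWedge`: `Z = 1/50`, `S_b = 1/20`, `S_e = 10²⁸`),
the renormalisation-factor Lipschitz numbers (`hγedge`: `10⁻⁶, 10⁻⁶, 10²²`), the bottom-shell ones (`hZedge`:
`10⁻³, 10⁻³, 10²⁰`), the per-shell ones (`hDedge`), the Krawczyk inclusion (`hwinIn`), the wake entry `A₁ = 10⁻⁵`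
(`hA1`).  Model lattice only; nothing about Navier–Stokes; does not close stmt-20205 (one `(ε₀, α)`).
[cite: Tao2016AveragedNS, §4 Lemma 4.1 (4.8), §5.3–§6; cell vocabulary, harvest/h2-tao-ladder rung1/RUNG1-P2G16-REPORT.md §79, rung1/RUNG1-P2G8-REPORT.md §33–§34] -/
theorem exists_surviving_dssWave_of_cert (cert : OneShiftWindowCert (T4W76R.frame bd) (1 / 10) αT4)
    (hAwin : ∀ w, (T4W76R.frame bd).Adm w → ∀ j k', (T4W76R.frame bd).InWindow k' → ∀ s ∈ Icc 0 (T4W76R.frame bd).τhi,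
      |(T4W76R.frame bd).fullFamily cert w j k' s| ≤ AT4₂ k')
    (hgl : ∀ w, (T4W76R.frame bd).Adm w →
      gLo ≤ gfac (slice ((T4W76R.frame bd).fullFamily cert w) ((T4W76R.frame bd).decodeTau w)) ∧
        gfac (slice ((T4W76R.frame bd).fullFamily cert w) ((T4W76R.frame bd).decodeTau w)) ≤ gHi)
    (hWedge : ∀ u v, (T4W76R.frame bd).AdmLip RT4₂ u → (T4W76R.frame bd).AdmLip RT4₂ v → ∀ B E : ℝ,
      (∀ i, ∀ t ∈ Icc 0 (T4W76R.frame bd).τhi, |(T4W76R.frame bd).decodeTail u i (-1) t - (T4W76R.frame bd).decodeTail v i (-1) t| ≤ B) →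
      (∀ i, ∀ t ∈ Icc 0 (T4W76R.frame bd).τhi,
        |(T4W76R.frame bd).decodeTail u i (T4W76R.frame bd).W t - (T4W76R.frame bd).decodeTail v i (T4W76R.frame bd).W t| ≤ E) →
        dist ((T4W76R.frame bd).rawWindow cert u) ((T4W76R.frame bd).rawWindow cert v) ≤
          1 / 50 * dist u v + 1 / 20 * B + 10 ^ 28 * E)
    (hγedge : ∀ u v, (T4W76R.frame bd).AdmLip RT4₂ u → (T4W76R.frame bd).AdmLip RT4₂ v → ∀ B E : ℝ,
      (∀ i, ∀ t ∈ Icc 0 (T4W76R.frame bd).τhi, |(T4W76R.frame bd).decodeTail u i (-1) t - (T4W76R.frame bd).decodeTail v i (-1) t| ≤ B) →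
      (∀ i, ∀ t ∈ Icc 0 (T4W76R.frame bd).τhi,
        |(T4W76R.frame bd).decodeTail u i (T4W76R.frame bd).W t - (T4W76R.frame bd).decodeTail v i (T4W76R.frame bd).W t| ≤ E) →
        |gfac (slice ((T4W76R.frame bd).fullFamily cert u) ((T4W76R.frame bd).decodeTau u)) -
          gfac (slice ((T4W76R.frame bd).fullFamily cert v) ((T4W76R.frame bd).decodeTau v))| ≤
          1 / 10 ^ 6 * dist u v + 1 / 10 ^ 6 * B + 10 ^ 22 * E)
    (hZedge : ∀ u v, (T4W76R.frame bd).AdmLip RT4₂ u → (T4W76R.frame bd).AdmLip RT4₂ v → ∀ i, ∀ B E : ℝ,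
      (∀ i, ∀ t ∈ Icc 0 (T4W76R.frame bd).τhi, |(T4W76R.frame bd).decodeTail u i (-1) t - (T4W76R.frame bd).decodeTail v i (-1) t| ≤ B) →
      (∀ i, ∀ t ∈ Icc 0 (T4W76R.frame bd).τhi,
        |(T4W76R.frame bd).decodeTail u i (T4W76R.frame bd).W t - (T4W76R.frame bd).decodeTail v i (T4W76R.frame bd).W t| ≤ E) →
        |(T4W76R.frame bd).fullFamily cert u i 0 ((T4W76R.frame bd).decodeTau u) -
          (T4W76R.frame bd).fullFamily cert v i 0 ((T4W76R.frame bd).decodeTau v)| ≤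
          1 / 10 ^ 3 * dist u v + 1 / 10 ^ 3 * B + 10 ^ 20 * E)
    (hDedge : ∀ u v, (T4W76R.frame bd).AdmLip RT4₂ u → (T4W76R.frame bd).AdmLip RT4₂ v → ∀ j k', (T4W76R.frame bd).InWindow k' →
      ∀ s ∈ Icc 0 (T4W76R.frame bd).τhi, ∀ B E : ℝ,
      (∀ i, ∀ t ∈ Icc 0 (T4W76R.frame bd).τhi, |(T4W76R.frame bd).decodeTail u i (-1) t - (T4W76R.frame bd).decodeTail v i (-1) t| ≤ B) →
      (∀ i, ∀ t ∈ Icc 0 (T4W76R.frame bd).τhi,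
        |(T4W76R.frame bd).decodeTail u i (T4W76R.frame bd).W t - (T4W76R.frame bd).decodeTail v i (T4W76R.frame bd).W t| ≤ E) →
        |(T4W76R.frame bd).fullFamily cert u j k' s - (T4W76R.frame bd).fullFamily cert v j k' s| ≤
          vmaxT4₂ k' * dist u v + χbT4₂ k' * B + χeT4₂ k' * E)
    (hwinIn : ∀ u, (T4W76R.frame bd).AdmLip RT4₂ u →
      (∀ i k, |((T4W76R.frame bd).rawWindow cert u).1 i k| ≤ 1) ∧ |((T4W76R.frame bd).rawWindow cert u).2| ≤ 1)
    (hA1 : ∀ w, (T4W76R.frame bd).Adm w → ∀ i,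
      |gfac (slice ((T4W76R.frame bd).fullFamily cert w) ((T4W76R.frame bd).decodeTau w)) *
          (T4W76R.frame bd).fullFamily cert w i 0 ((T4W76R.frame bd).decodeTau w) - (T4W76R.frame bd).tubeC i (-1)| ≤ 1 / 10 ^ 5) :
    ∃ (T : ℝ) (Φ : Unit → ℝ → Em 4), 0 < T ∧ IsDSSWave (1 / 10) αT4 (Equiv.refl Unit) T Φ ∧
      Surviving 1 (1 / 10) T ∧ ∃ x, Φ () x ≠ 0 := by
  obtain ⟨hΛlo, hΛhi⟩ := bigLam_tenth_bounds
  have hΛ1 : 1 ≤ bigLam (1 / 10 : ℝ) := one_le_bigLam (by norm_num)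
  have hpos : 0 < bigLam (1 / 10 : ℝ) := by linarith
  have hw1 : 0 < (T4W76R.frame bd).wt (-1) := by rw [frame_wt]; exact wtT4_pos _
  have hwW : 0 < (T4W76R.frame bd).wt (T4W76R.frame bd).W := by rw [frame_wt]; exact wtT4_pos _
  exact (T4W76R.frame bd).exists_surviving_dssWave_of_windowCert_v7s cert RT4₂ AT4₂ vmaxT4₂ χbT4₂ χeT4₂
    (Mα := 1) (Q := Q) (β := βw) (q := 13 / 25) (gLo := gLo) (gHi := gHi) (A1 := 1 / 10 ^ 5) (S := S)
    (ω := 1) (θ := θw) (κ := κw) (ωt := ωt) (ϑ := ϑt) (abart := abart₂) (ϑR := ϑt) (εR := εR)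
    (ghat := ghat) (cmax := cmax) (r₀ := r₀) (δ' := 1 / 100) (c₀ := fun i => bd.yc i 0)
    (hε := by norm_num) (hΛ1 := hΛ1) (hMα := zero_le_one) (hα := abs_αT4_le_one)
    (hW1 := by simp [frame]) (hq := by norm_num) (hq1 := by norm_num) (hA0 := AT4₂_nonneg) (hAwin := hAwin)
    (hR0 := RT4₂_nonneg) (hS := tableAbsSum_αT4_le) (hRW := RT4₂_wake) (hRT := RT4₂_top)
    (hRBm1 := row_RBm1₂) (hRBW := row_RBW₂ bd) (hgl := hgl)
    (hgLo1 := by unfold gLo; norm_num) (hgHi2 := by unfold gHi; norm_num)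
    (hgHiΛ := lt_of_lt_of_le (by unfold gHi; norm_num) hΛlo)
    (hβgLo := lt_of_lt_of_le (by unfold βw gHi gLo; norm_num)
      (mul_le_mul_of_nonneg_left hΛlo (by unfold gLo; norm_num)))
    (hĝlo := by unfold gLo T4W76.ghat; norm_num) (hĝgHi := by unfold T4W76.ghat gHi; norm_num)
    (hWedge := hWedge) (hγedge := hγedge) (hZedge := hZedge) (hDedge := hDedge) (hqX := row_qX bd)
    (hDwin0 := fun k' _ => add_nonneg (add_nonneg (vmaxT4₂_nonneg k') (mul_nonneg (χbT4₂_nonneg k') hw1.le))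
      (mul_nonneg (χeT4₂_nonneg k') hwW.le))
    (hγ0 := add_nonneg (add_nonneg (by norm_num) (mul_nonneg (by norm_num) hw1.le))
      (mul_nonneg (by norm_num) hwW.le))
    (hθ := by unfold θw gHi; norm_num) (hβ1 := by unfold βw gHi; norm_num)
    (hβθ := by unfold βw θw gHi; norm_num) (hβΛ := le_trans (by unfold βw gHi; norm_num) hΛlo)
    (hω := zero_le_one) (hδ' := by norm_num) (hβge := le_rfl) (hr₀ := by unfold r₀; norm_num)
    (hκ := by unfold T4W76.κw; norm_num) (hc := bd.yc_le)
    (hQ := by unfold T4W76.cmax r₀ T4W76.κw T4W76.Q; norm_num)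
    (hσξ := by
      rw [mul_inv_le_iff₀ hpos]
      exact le_trans (by unfold βw gHi; norm_num) (mul_le_mul_of_nonneg_left hΛlo (by unfold gHi; norm_num)))
    (hwtW := wtT4_wake) (htubeRW := tubeRT4_wake) (htubeCW := tubeCT4_wake fun i => bd.yc i 0) (hAW := AT4₂_wake)
    (hϑ0 := by unfold ϑt; norm_num) (hϑ1 := by unfold ϑt; norm_num) (hϑR := by unfold ϑt; norm_num)
    (hϑRϑ := le_rfl) (hϑRΛ := by unfold ϑt; linarith) (hωt := by unfold T4W76.ωt; norm_num)
    (hAlast := by show AT4₂ (((76 : ℕ) : ℤ) - 1) ≤ abart₂; norm_num [AT4₂])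
    (hεab := by unfold T4W76.εR abart₂ ϑt; norm_num)
    (hwtT := wtT4_top) (htubeRT := tubeRT4_top) (htubeCT := tubeCT4_top fun i => bd.yc i 0) (hAT := AT4₂_top)
    (hfirstW := row_firstW bd) (hfirstWS := row_firstWS bd) (hfirstT := row_firstT₂ bd) (hfirstTS := row_firstTS₂ bd)
    (hrowB := row_B₂ bd) (hrowT := row_T₂ bd) (hrow1 := row_1₂ bd)
    (hwinIn := hwinIn) (hA1 := hA1) (hQA := by norm_num [AT4₂]) (hne := bd.yc_ne)

/-- **Counter-instance SHAPE for K1(1) at one scale ratio, conditional on the certificate (replay-sized variant)**: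
under the same certificate-side hypotheses, the comparable class `E₂(15)` contains a table (T4) carrying a surviving
admissible DSS blow-up wave at `1 + ε₀ = 11/10`.  (K1(1) = `NoSurvivingDSSOne` asks for NO such wave for all
`ε₀ ≤ ε_s(R)` with `ε_s` free, so one `ε₀` does not decide it.)  Model lattice only; nothing about Navier–Stokes.
[cite: Tao2016AveragedNS, §4 (4.2)–(4.3), §6.1, §5.3–§6; cell vocabulary (`InTableClass`), module …CircuitTableT4, harvest/h2-tao-ladder rung1/RUNG1-P2G16-REPORT.md §79] -/
theorem exists_inTableClass_surviving_dssWave_of_cert (cert : OneShiftWindowCert (T4W76R.frame bd) (1 / 10) αT4)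
    (hAwin : ∀ w, (T4W76R.frame bd).Adm w → ∀ j k', (T4W76R.frame bd).InWindow k' → ∀ s ∈ Icc 0 (T4W76R.frame bd).τhi,
      |(T4W76R.frame bd).fullFamily cert w j k' s| ≤ AT4₂ k')
    (hgl : ∀ w, (T4W76R.frame bd).Adm w →
      gLo ≤ gfac (slice ((T4W76R.frame bd).fullFamily cert w) ((T4W76R.frame bd).decodeTau w)) ∧
        gfac (slice ((T4W76R.frame bd).fullFamily cert w) ((T4W76R.frame bd).decodeTau w)) ≤ gHi)
    (hWedge : ∀ u v, (T4W76R.frame bd).AdmLip RT4₂ u → (T4W76R.frame bd).AdmLip RT4₂ v → ∀ B E : ℝ,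
      (∀ i, ∀ t ∈ Icc 0 (T4W76R.frame bd).τhi, |(T4W76R.frame bd).decodeTail u i (-1) t - (T4W76R.frame bd).decodeTail v i (-1) t| ≤ B) →
      (∀ i, ∀ t ∈ Icc 0 (T4W76R.frame bd).τhi,
        |(T4W76R.frame bd).decodeTail u i (T4W76R.frame bd).W t - (T4W76R.frame bd).decodeTail v i (T4W76R.frame bd).W t| ≤ E) →
        dist ((T4W76R.frame bd).rawWindow cert u) ((T4W76R.frame bd).rawWindow cert v) ≤
          1 / 50 * dist u v + 1 / 20 * B + 10 ^ 28 * E)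
    (hγedge : ∀ u v, (T4W76R.frame bd).AdmLip RT4₂ u → (T4W76R.frame bd).AdmLip RT4₂ v → ∀ B E : ℝ,
      (∀ i, ∀ t ∈ Icc 0 (T4W76R.frame bd).τhi, |(T4W76R.frame bd).decodeTail u i (-1) t - (T4W76R.frame bd).decodeTail v i (-1) t| ≤ B) →
      (∀ i, ∀ t ∈ Icc 0 (T4W76R.frame bd).τhi,
        |(T4W76R.frame bd).decodeTail u i (T4W76R.frame bd).W t - (T4W76R.frame bd).decodeTail v i (T4W76R.frame bd).W t| ≤ E) →
        |gfac (slice ((T4W76R.frame bd).fullFamily cert u) ((T4W76R.frame bd).decodeTau u)) -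
          gfac (slice ((T4W76R.frame bd).fullFamily cert v) ((T4W76R.frame bd).decodeTau v))| ≤
          1 / 10 ^ 6 * dist u v + 1 / 10 ^ 6 * B + 10 ^ 22 * E)
    (hZedge : ∀ u v, (T4W76R.frame bd).AdmLip RT4₂ u → (T4W76R.frame bd).AdmLip RT4₂ v → ∀ i, ∀ B E : ℝ,
      (∀ i, ∀ t ∈ Icc 0 (T4W76R.frame bd).τhi, |(T4W76R.frame bd).decodeTail u i (-1) t - (T4W76R.frame bd).decodeTail v i (-1) t| ≤ B) →
      (∀ i, ∀ t ∈ Icc 0 (T4W76R.frame bd).τhi,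
        |(T4W76R.frame bd).decodeTail u i (T4W76R.frame bd).W t - (T4W76R.frame bd).decodeTail v i (T4W76R.frame bd).W t| ≤ E) →
        |(T4W76R.frame bd).fullFamily cert u i 0 ((T4W76R.frame bd).decodeTau u) -
          (T4W76R.frame bd).fullFamily cert v i 0 ((T4W76R.frame bd).decodeTau v)| ≤
          1 / 10 ^ 3 * dist u v + 1 / 10 ^ 3 * B + 10 ^ 20 * E)
    (hDedge : ∀ u v, (T4W76R.frame bd).AdmLip RT4₂ u → (T4W76R.frame bd).AdmLip RT4₂ v → ∀ j k', (T4W76R.frame bd).InWindow k' →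
      ∀ s ∈ Icc 0 (T4W76R.frame bd).τhi, ∀ B E : ℝ,
      (∀ i, ∀ t ∈ Icc 0 (T4W76R.frame bd).τhi, |(T4W76R.frame bd).decodeTail u i (-1) t - (T4W76R.frame bd).decodeTail v i (-1) t| ≤ B) →
      (∀ i, ∀ t ∈ Icc 0 (T4W76R.frame bd).τhi,
        |(T4W76R.frame bd).decodeTail u i (T4W76R.frame bd).W t - (T4W76R.frame bd).decodeTail v i (T4W76R.frame bd).W t| ≤ E) →
        |(T4W76R.frame bd).fullFamily cert u j k' s - (T4W76R.frame bd).fullFamily cert v j k' s| ≤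
          vmaxT4₂ k' * dist u v + χbT4₂ k' * B + χeT4₂ k' * E)
    (hwinIn : ∀ u, (T4W76R.frame bd).AdmLip RT4₂ u →
      (∀ i k, |((T4W76R.frame bd).rawWindow cert u).1 i k| ≤ 1) ∧ |((T4W76R.frame bd).rawWindow cert u).2| ≤ 1)
    (hA1 : ∀ w, (T4W76R.frame bd).Adm w → ∀ i,
      |gfac (slice ((T4W76R.frame bd).fullFamily cert w) ((T4W76R.frame bd).decodeTau w)) *
          (T4W76R.frame bd).fullFamily cert w i 0 ((T4W76R.frame bd).decodeTau w) - (T4W76R.frame bd).tubeC i (-1)| ≤ 1 / 10 ^ 5) :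
    ∃ α : Fin 4 → Fin 4 → Fin 4 → ℤ × ℤ × ℤ → ℝ, InTableClass 15 α ∧
      ∃ (T : ℝ) (Φ : Unit → ℝ → Em 4), 0 < T ∧ IsDSSWave (1 / 10) α (Equiv.refl Unit) T Φ ∧
        Surviving 1 (1 / 10) T ∧ ∃ x, Φ () x ≠ 0 :=
  ⟨αT4, inTableClass_circuitTable_T4 (ε₀ := 1 / 10) (by norm_num) (by norm_num),
    exists_surviving_dssWave_of_cert bd cert hAwin hgl hWedge hγedge hZedge hDedge hwinIn hA1⟩

end T4W76R

end DSSOneShift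

end Summit.NavierStokesRegularity.NavierStokesRegularity.Theorems
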